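import Mathlib
import Summits.Ventures.PercRepro2.SwOutAll
import Summits.Ventures.PercRepro2.SwOutArmFlip
import Summits.Ventures.PercRepro2.SwOutJunctionsSplit
import Summits.Ventures.PercRepro2.SwOutAdjSplit

/-!
# Fine configurations for a set of split vertices with internal edges (blind cell PercRepro2,
night-4 g11, 2026-08-25; proofs/NIGHT4-G11.md §5(5))

`EdgeMatched`: a red edge has both ends in `C_R(h)`, a blue edge both ends in `C_B(h)` (the
symmetric form of «matched»).  `AFine`: every copy of a NON-INTERNAL edge at `S` lies in the split
hull.  On an `S`-fine configuration the red cluster of `h` is the split cluster on `V ∖ S` together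
with the INTERNAL red cluster of the ACTIVE vertices of `S` (those with a red non-internal edge):
`cluster_eq_of_afine`; the red edge set is the split red edge set together with the red internal
edges inside that internal cluster: `redEdges_eq_of_afine`.  `S`-fine follows from
edge-matchedness of the non-internal edges at `S` when every neighbour `p ≠ h` of `S` is adjacent
to `h` and the cores lie in `{h} ∪ S` (`afine_of_edgeMatched`).
-/

namespace Summit.Ventures.PercRepro2

namespace LocRows

open Hull

variable {V : Type*} {E : Type*} [Fintype E] [DecidableEq E]

open scoped Classical

section AdjFine

variable (ends : E → Sym2 V) (S : Set V) (h : V)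

/-- **Edge-matched**: red with both ends in `C_R(h)`, or blue with both ends in `C_B(h)`. -/
def EdgeMatched (η : Config E) (e : E) : Prop :=
  (η e = true → ∀ x ∈ ends e, x ∈ cluster ends η h) ∧
  (η e = false → ∀ x ∈ ends e, x ∈ cluster ends (blue η) h)

/-- **`S`-fine** (adjacency version): every copy of a non-internal edge at `S` lies in the split
hull of `h`. -/
def AFine (η : Config E) : Prop :=
  ∀ e, (∃ u ∈ S, u ∈ ends e) → ¬ Internal ends S e →
    Sum.inr e ∈ hull (splitEndsS ends S) η (Sum.inl h)

/-- The internal graph of `S`: the internal edges, every other edge turned into a loop at `h`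
(which connects nothing). -/
noncomputable def intEnds : E → Sym2 V := fun e => if Internal ends S e then ends e else s(h, h)

/-- The **active** vertices of `S`: those with a red non-internal edge. -/
def activeRed (η : Config E) : Set V :=
  {w | w ∈ S ∧ ∃ e, w ∈ ends e ∧ ¬ Internal ends S e ∧ η e = true}

/-- The red internal cluster of the active vertices. -/
def intCluster (η : Config E) : Set V :=
  {x | ∃ w ∈ activeRed ends S η, x ∈ cluster (intEnds ends S h) η w}

variable {ends S h}

omit [Fintype E] [DecidableEq E] in
/-- Edge-matchedness is colour-symmetric. -/
lemma edgeMatched_blue_iff {η : Config E} {e : E} :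
    EdgeMatched ends h (blue η) e ↔ EdgeMatched ends h η e := by
  simp only [EdgeMatched, blue_blue, blue_apply]
  cases η e <;> simp

omit [Fintype E] [DecidableEq E] in
/-- `S`-fineness is colour-symmetric. -/
lemma afine_blue_iff {η : Config E} : AFine ends S h (blue η) ↔ AFine ends S h η := by
  simp only [AFine, hull_blue]

omit [Fintype E] [DecidableEq E] in
/-- A core is edge-matched at all its edges. -/
lemma edgeMatched_of_core {η : Config E} {u : V} (hT : u ∈ cluster ends η h)
    (hTp : u ∈ cluster ends (blue η) h) {e : E} (he : u ∈ ends e) : EdgeMatched ends h η e := by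
  constructor
  · intro hc x hx
    rw [ends_eq_otherS he, Sym2.mem_iff] at hx
    rcases hx with rfl | rfl
    · exact hT
    · exact mem_cluster_of_edge hT hc (ends_eq_otherS he)
  · intro hc x hx
    have hb : blue η e = true := by rw [blue_eq_true_iff]; exact hc
    rw [ends_eq_otherS he, Sym2.mem_iff] at hx
    rcases hx with rfl | rfl
    · exact hTp
    · exact mem_cluster_of_edge hTp hb (ends_eq_otherS he)

omit [Fintype E] [DecidableEq E] in
/-- The internal graph keeps the internal edges. -/
lemma intEnds_of_internal {e : E} (hi : Internal ends S e) : intEnds ends S h e = ends e := by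
  simp only [intEnds, if_pos hi]

omit [Fintype E] [DecidableEq E] in
/-- The internal graph turns a non-internal edge into a loop at `h`. -/
lemma intEnds_of_not_internal {e : E} (hi : ¬ Internal ends S e) :
    intEnds ends S h e = s(h, h) := by
  simp only [intEnds, if_neg hi]

omit [Fintype E] [DecidableEq E] in
/-- The internal cluster of a vertex of `S` stays in `S`. -/
lemma cluster_intEnds_subset {η : Config E} {w : V} (hw : w ∈ S) :
    cluster (intEnds ends S h) η w ⊆ S := by
  intro x hx
  refine mem_of_conn_of_closed (ends := intEnds ends S h) (ω := η) ?_ hw hx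
  intro a _ b hab
  obtain ⟨hne, e, _, hends⟩ := openGraph_adj.1 hab
  by_cases hi : Internal ends S e
  · rw [intEnds_of_internal hi] at hends
    exact hi b (by rw [hends]; exact Sym2.mem_mk_right _ _)
  · rw [intEnds_of_not_internal hi, Sym2.eq_iff] at hends
    rcases hends with ⟨h1, h2⟩ | ⟨h1, h2⟩
    · exact absurd (h1.symm.trans h2) hne
    · exact absurd (h2.symm.trans h1) hne

omit [Fintype E] [DecidableEq E] in
/-- The internal cluster lies in `S`. -/
lemma intCluster_subset {η : Config E} : intCluster ends S h η ⊆ S := by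
  rintro x ⟨w, hw, hx⟩
  exact cluster_intEnds_subset hw.1 hx

omit [Fintype E] [DecidableEq E] in
/-- The internal cluster is closed under red internal edges. -/
lemma mem_intCluster_of_edge {η : Config E} {x y : V} (hx : x ∈ intCluster ends S h η) {e : E}
    (hi : Internal ends S e) (hred : η e = true) (hxy : ends e = s(x, y)) :
    y ∈ intCluster ends S h η := by
  obtain ⟨w, hw, hxw⟩ := hx
  exact ⟨w, hw, mem_cluster_of_edge hxw hred (by rw [intEnds_of_internal hi]; exact hxy)⟩

omit [Fintype E] [DecidableEq E] in
/-- A copy in the split hull lies on the side of its own colour. -/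
lemma inr_mem_cluster_splitS_of_afine {η : Config E} (hf : AFine ends S h η) {e : E} {u : V}
    (hu : u ∈ S) (he : u ∈ ends e) (hi : ¬ Internal ends S e) (hred : η e = true) :
    Sum.inr e ∈ cluster (splitEndsS ends S) η (Sum.inl h) := by
  have hp := other_notMem_of_not_internal hu he hi
  rcases hf e ⟨u, hu, he⟩ hi with h1 | h1
  · exact h1
  · rw [inr_mem_cluster_splitS_iff' hu he hp, blue_eq_true_iff] at h1
    rw [h1.1] at hred
    exact absurd hred (by simp)

omit [Fintype E] [DecidableEq E] in
/-- A red non-internal edge at `S` of an `S`-fine configuration has both ends in `C_R(h)`. -/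
lemma ends_mem_cluster_of_afine {η : Config E} (hf : AFine ends S h η) {e : E} {u : V}
    (hu : u ∈ S) (he : u ∈ ends e) (hi : ¬ Internal ends S e) (hred : η e = true) :
    ∀ x ∈ ends e, x ∈ cluster ends η h := by
  have hp := other_notMem_of_not_internal hu he hi
  have h1 := inr_mem_cluster_splitS_of_afine hf hu he hi hred
  rw [inr_mem_cluster_splitS_iff' hu he hp] at h1
  have hoth : Sym2.Mem.other he ∈ cluster ends η h := conn_of_conn_splitS_inl' h1.2
  intro x hx
  rw [ends_eq_otherS he, Sym2.mem_iff] at hx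
  rcases hx with rfl | rfl
  · exact mem_cluster_of_edge hoth hred (ends_swap (ends_eq_otherS he))
  · exact hoth

omit [Fintype E] [DecidableEq E] in
/-- **`S`-fine gives edge-matched** at every non-internal edge at `S`. -/
theorem edgeMatched_of_afine {η : Config E} (hf : AFine ends S h η) {e : E} {u : V} (hu : u ∈ S)
    (he : u ∈ ends e) (hi : ¬ Internal ends S e) : EdgeMatched ends h η e :=
  ⟨ends_mem_cluster_of_afine hf hu he hi,
    fun hb => ends_mem_cluster_of_afine (afine_blue_iff.2 hf) hu he hi
      (by rw [blue_eq_true_iff]; exact hb)⟩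

omit [Fintype E] [DecidableEq E] in
/-- The active vertices lie in `C_R(h)`. -/
lemma activeRed_subset_cluster {η : Config E} (hf : AFine ends S h η) :
    activeRed ends S η ⊆ cluster ends η h := by
  rintro w ⟨hwS, e, hwe, hi, hred⟩
  exact ends_mem_cluster_of_afine hf hwS hwe hi hred w hwe

omit [Fintype E] [DecidableEq E] in
/-- The internal cluster lies in `C_R(h)`. -/
lemma intCluster_subset_cluster {η : Config E} (hf : AFine ends S h η) :
    intCluster ends S h η ⊆ cluster ends η h := by
  rintro x ⟨w, hw, hx⟩
  refine mem_of_conn_of_closed (ends := intEnds ends S h) (ω := η) ?_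
    (activeRed_subset_cluster hf hw) hx
  intro a ha b hab
  obtain ⟨hne, e, he, hends⟩ := openGraph_adj.1 hab
  by_cases hi : Internal ends S e
  · rw [intEnds_of_internal hi] at hends
    exact mem_cluster_of_edge ha he hends
  · rw [intEnds_of_not_internal hi, Sym2.eq_iff] at hends
    rcases hends with ⟨h1, h2⟩ | ⟨h1, h2⟩
    · exact absurd (h1.symm.trans h2) hne
    · exact absurd (h2.symm.trans h1) hne

omit [Fintype E] [DecidableEq E] in
/-- **The red cluster of `h` through the split** (`S`-fine, `h ∉ S`): the split cluster on
`V ∖ S` together with the internal cluster of the active vertices. -/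
theorem cluster_eq_of_afine (hhS : h ∉ S) {η : Config E} (hf : AFine ends S h η) :
    cluster ends η h =
      {x | x ∉ S ∧ Sum.inl x ∈ cluster (splitEndsS ends S) η (Sum.inl h)} ∪
        intCluster ends S h η := by
  apply Set.Subset.antisymm
  · intro x hx
    refine mem_of_conn_of_closed (ends := ends) (ω := η) ?_
      (Or.inl ⟨hhS, mem_cluster_self _ _ _⟩) hx
    intro a ha b hab
    obtain ⟨hne, e, he, hends⟩ := openGraph_adj.1 hab
    have hae : a ∈ ends e := by rw [hends]; exact Sym2.mem_mk_left _ _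
    have hbe : b ∈ ends e := by rw [hends]; exact Sym2.mem_mk_right _ _
    rcases ha with ⟨haS, haC⟩ | haI
    · by_cases hbS : b ∈ S
      · right
        have hi : ¬ Internal ends S e := fun hi => haS (hi a hae)
        exact ⟨b, ⟨hbS, e, hbe, hi, he⟩, mem_cluster_self _ _ _⟩
      · left
        exact ⟨hbS, mem_cluster_of_edge (v := Sum.inl h) haC he
          (splitEndsS_of_notMem hends haS hbS)⟩
    · have haS : a ∈ S := intCluster_subset haI
      by_cases hbS : b ∈ S
      · right
        exact mem_intCluster_of_edge haI (internal_of_ends hends haS hbS) he hends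
      · left
        have hi : ¬ Internal ends S e := fun hi => hbS (hi b hbe)
        have hoth : Sym2.Mem.other hae = b := other_eq_of_endsS hae hends (Ne.symm hne)
        have hcopy := inr_mem_cluster_splitS_of_afine hf haS hae hi he
        rw [inr_mem_cluster_splitS_iff' haS hae (by rw [hoth]; exact hbS), hoth] at hcopy
        exact ⟨hbS, hcopy.2⟩
  · rintro x (⟨_, hx⟩ | hx)
    · exact conn_of_conn_splitS_inl' hx
    · exact intCluster_subset_cluster hf hx

omit [Fintype E] [DecidableEq E] in
/-- The `inl`-membership half of `cluster_eq_of_afine`. -/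
lemma inl_mem_cluster_splitS_iff_of_afine (hhS : h ∉ S) {η : Config E} (hf : AFine ends S h η)
    {x : V} (hxS : x ∉ S) :
    Sum.inl x ∈ cluster (splitEndsS ends S) η (Sum.inl h) ↔ x ∈ cluster ends η h := by
  constructor
  · exact conn_of_conn_splitS_inl'
  · intro hx
    rw [cluster_eq_of_afine hhS hf] at hx
    rcases hx with ⟨_, h1⟩ | h1
    · exact h1
    · exact absurd (intCluster_subset h1) hxS

omit [Fintype E] [DecidableEq E] in
/-- A vertex of `S` in `C_R(h)` lies in the internal cluster (`S`-fine, `h ∉ S`). -/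
lemma mem_intCluster_of_mem_cluster (hhS : h ∉ S) {η : Config E} (hf : AFine ends S h η)
    {x : V} (hxS : x ∈ S) (hx : x ∈ cluster ends η h) : x ∈ intCluster ends S h η := by
  rw [cluster_eq_of_afine hhS hf] at hx
  rcases hx with ⟨h1, _⟩ | h1
  · exact absurd hxS h1
  · exact h1

omit [Fintype E] [DecidableEq E] in
/-- **The red edge set through the split** (`S`-fine, `h ∉ S`): the split red edge set together
with the red internal edges inside the internal cluster. -/
theorem redEdges_eq_of_afine (hhS : h ∉ S) {η : Config E} (hf : AFine ends S h η) :
    redEdges ends η h = redEdges (splitEndsS ends S) η (Sum.inl h) ∪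
      {e | Internal ends S e ∧ η e = true ∧ ∀ x ∈ ends e, x ∈ intCluster ends S h η} := by
  ext e
  simp only [mem_redEdges, mem_within, Set.mem_union, Set.mem_setOf_eq]
  constructor
  · rintro ⟨he, x, hx, y, hy, hxy⟩
    by_cases hi : Internal ends S e
    · right
      refine ⟨hi, he, fun z hz => ?_⟩
      have hzT : z ∈ cluster ends η h := by
        rw [hxy, Sym2.mem_iff] at hz
        rcases hz with rfl | rfl
        · exact hx
        · exact hy
      exact mem_intCluster_of_mem_cluster hhS hf (hi z hz) hzT
    left
    refine ⟨he, ?_⟩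
    by_cases hu : ∃ u ∈ S, u ∈ ends e
    · obtain ⟨u, huS, hue⟩ := hu
      have hp : Sym2.Mem.other hue ∈ cluster ends η h := by
        have h1 : s(u, Sym2.Mem.other hue) = s(x, y) := (Sym2.other_spec hue).trans hxy
        rw [Sym2.eq_iff] at h1
        rcases h1 with ⟨_, h2⟩ | ⟨_, h2⟩
        · rw [h2]; exact hy
        · rw [h2]; exact hx
      have hpS := other_notMem_of_not_internal huS hue hi
      have hp' : Sum.inl (Sym2.Mem.other hue) ∈ cluster (splitEndsS ends S) η (Sum.inl h) :=
        (inl_mem_cluster_splitS_iff_of_afine hhS hf hpS).2 hp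
      refine ⟨Sum.inr e, ?_, Sum.inl (Sym2.Mem.other hue), hp',
        splitEndsS_of_not_internal huS hue hi⟩
      rw [inr_mem_cluster_splitS_iff' huS hue hpS]
      exact ⟨he, hp'⟩
    · push Not at hu
      have hxS : x ∉ S := fun h' => hu x h' (by rw [hxy]; exact Sym2.mem_mk_left _ _)
      have hyS : y ∉ S := fun h' => hu y h' (by rw [hxy]; exact Sym2.mem_mk_right _ _)
      exact ⟨Sum.inl x, (inl_mem_cluster_splitS_iff_of_afine hhS hf hxS).2 hx,
        Sum.inl y, (inl_mem_cluster_splitS_iff_of_afine hhS hf hyS).2 hy,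
        splitEndsS_of_notMem hxy hxS hyS⟩
  · rintro (⟨he, x', hx', y', hy', hxy⟩ | ⟨hi, he, hI⟩)
    · refine ⟨he, ?_⟩
      rcases splitEndsS_cases (ends := ends) (S := S) e with
        ⟨p, q, hpq, _, _, hsplit⟩ | ⟨u, huS, hue, hpS, hsplit⟩ | ⟨hi, hsplit⟩
      · rw [hsplit, Sym2.eq_iff] at hxy
        rcases hxy with ⟨h1, h2⟩ | ⟨h1, h2⟩
        · rw [← h1] at hx'; rw [← h2] at hy'
          exact ⟨p, conn_of_conn_splitS_inl' hx', q, conn_of_conn_splitS_inl' hy', hpq⟩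
        · rw [← h1] at hy'; rw [← h2] at hx'
          exact ⟨p, conn_of_conn_splitS_inl' hy', q, conn_of_conn_splitS_inl' hx', hpq⟩
      · rw [hsplit, Sym2.eq_iff] at hxy
        have hp : Sum.inl (Sym2.Mem.other hue) ∈ cluster (splitEndsS ends S) η (Sum.inl h) := by
          rcases hxy with ⟨_, h1⟩ | ⟨_, h1⟩
          · rw [h1]; exact hy'
          · rw [h1]; exact hx'
        have hpT : Sym2.Mem.other hue ∈ cluster ends η h := conn_of_conn_splitS_inl' hp
        refine ⟨Sym2.Mem.other hue, hpT, u, ?_, ends_swap (ends_eq_otherS hue)⟩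
        exact mem_cluster_of_edge hpT he (ends_swap (ends_eq_otherS hue))
      · exfalso
        rw [hsplit, Sym2.eq_iff] at hxy
        rcases hxy with ⟨h1, _⟩ | ⟨_, h1⟩ <;> rw [← h1] at hx' <;>
          exact inr_notMem_cluster_splitS_of_internal hi hx'
    · refine ⟨he, ?_⟩
      obtain ⟨x, y, hxy⟩ := exists_pairS (ends e)
      refine ⟨x, intCluster_subset_cluster hf (hI x (by rw [hxy]; exact Sym2.mem_mk_left _ _)),
        y, intCluster_subset_cluster hf (hI y (by rw [hxy]; exact Sym2.mem_mk_right _ _)), hxy⟩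

omit [Fintype E] [DecidableEq E] in
/-- **The blue edge set through the split.** -/
theorem blueEdges_eq_of_afine (hhS : h ∉ S) {η : Config E} (hf : AFine ends S h η) :
    blueEdges ends η h = blueEdges (splitEndsS ends S) η (Sum.inl h) ∪
      {e | Internal ends S e ∧ blue η e = true ∧
        ∀ x ∈ ends e, x ∈ intCluster ends S h (blue η)} :=
  redEdges_eq_of_afine hhS (afine_blue_iff.2 hf)

omit [Fintype E] [DecidableEq E] in
/-- **Edge-matched gives the copy in the split hull** (non-internal edge `e` at `u ∈ S`; `h ∉ S`;
the other end adjacent to `h` unless it is `h`; the cores in `{h} ∪ S`). -/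
theorem inr_mem_hull_of_edgeMatched (hhS : h ∉ S) {η : Config E}
    (hcore : ∀ x, x ∈ cluster ends η h → x ∈ cluster ends (blue η) h → x = h ∨ x ∈ S)
    {e : E} {u : V} (hu : u ∈ S) (he : u ∈ ends e) (hi : ¬ Internal ends S e)
    (hadj : Sym2.Mem.other he ≠ h → ∃ e', ends e' = s(Sym2.Mem.other he, h))
    (hm : EdgeMatched ends h η e) :
    Sum.inr e ∈ hull (splitEndsS ends S) η (Sum.inl h) := by
  have hpS := other_notMem_of_not_internal hu he hi
  by_cases hph : Sym2.Mem.other he = h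
  · cases hc : η e with
    | true =>
      left
      rw [inr_mem_cluster_splitS_iff' hu he hpS, hph]
      exact ⟨hc, mem_cluster_self _ _ _⟩
    | false =>
      right
      rw [inr_mem_cluster_splitS_iff' hu he hpS, hph]
      exact ⟨by rw [blue_eq_true_iff]; exact hc, mem_cluster_self _ _ _⟩
  · obtain ⟨e', he'⟩ := hadj hph
    have hsplit : splitEndsS ends S e' = s(Sum.inl (Sym2.Mem.other he), Sum.inl h) :=
      splitEndsS_of_notMem he' hpS hhS
    cases hc : η e with
    | true =>
      have hp : Sym2.Mem.other he ∈ cluster ends η h := hm.1 hc _ (Sym2.other_mem he)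
      left
      rw [inr_mem_cluster_splitS_iff' hu he hpS]
      refine ⟨hc, ?_⟩
      cases hc' : η e' with
      | true => exact mem_cluster_of_edge (mem_cluster_self _ _ _) hc' (ends_swap hsplit)
      | false =>
        have hb : blue η e' = true := by rw [blue_eq_true_iff]; exact hc'
        have hp' : Sym2.Mem.other he ∈ cluster ends (blue η) h :=
          mem_cluster_of_edge (mem_cluster_self _ _ _) hb (ends_swap he')
        rcases hcore _ hp hp' with h1 | h1
        · exact absurd h1 hph
        · exact absurd h1 hpS
    | false =>
      have hp : Sym2.Mem.other he ∈ cluster ends (blue η) h := hm.2 hc _ (Sym2.other_mem he)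
      right
      rw [inr_mem_cluster_splitS_iff' hu he hpS]
      refine ⟨by rw [blue_eq_true_iff]; exact hc, ?_⟩
      cases hc' : η e' with
      | true =>
        have hp' : Sym2.Mem.other he ∈ cluster ends η h :=
          mem_cluster_of_edge (mem_cluster_self _ _ _) hc' (ends_swap he')
        rcases hcore _ hp' hp with h1 | h1
        · exact absurd h1 hph
        · exact absurd h1 hpS
      | false =>
        have hb : blue η e' = true := by rw [blue_eq_true_iff]; exact hc'
        exact mem_cluster_of_edge (mem_cluster_self _ _ _) hb (ends_swap hsplit)

omit [Fintype E] [DecidableEq E] in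
/-- **Edge-matched at every non-internal edge at `S` gives `S`-fine** (`h ∉ S`, the neighbours
`p ≠ h` of `S` adjacent to `h`, the cores in `{h} ∪ S`). -/
theorem afine_of_edgeMatched (hhS : h ∉ S)
    (hadj : ∀ u ∈ S, ∀ e (he : u ∈ ends e), Sym2.Mem.other he ≠ h →
      ∃ e', ends e' = s(Sym2.Mem.other he, h))
    {η : Config E}
    (hcore : ∀ x, x ∈ cluster ends η h → x ∈ cluster ends (blue η) h → x = h ∨ x ∈ S)
    (hm : ∀ u ∈ S, ∀ e, u ∈ ends e → ¬ Internal ends S e → EdgeMatched ends h η e) :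
    AFine ends S h η := by
  rintro e ⟨u, hu, he⟩ hi
  exact inr_mem_hull_of_edgeMatched hhS hcore hu he hi (hadj u hu e he) (hm u hu e he hi)

end AdjFine

end LocRows

end Summit.Ventures.PercRepro2
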